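import Summits.AtomisticToContinuum.HydrodynamicLimit.Theorems.BoxDissipativeWeakStrongFluxClosureDominatedInMeasure
import Summits.AtomisticToContinuum.HydrodynamicLimit.Theorems.BoxDissipativeWeakStrongFluxClosureOfParts
import Summits.AtomisticToContinuum.HydrodynamicLimit.Theorems.BoxDissipativeWeakStrongFluxClosureCollisionalVirialTight
import HarnessLib

/-!
# Crux `FluxClosure` (stmt-AtomisticToContinuum-9902, route BoxDissipativeWeakStrong), line `registered`:
# the collisional deviation tends to `0` in `L¹(P_N)` as soon as it tends to `0` in `P_N`-probability (wave-2 piece W2b)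

Support file (`--supports stmt-AtomisticToContinuum-9902`) of the lead prover of the crux
`Summit.AtomisticToContinuum.HydrodynamicLimit.Theses.BoxDissipativeWeakStrong.FluxClosure`. It proves the
registered FORMAT LEMMA `collisionalVirial_of_inProbability` for the open collisional stub V
(`stub_collisionalVirial`, stated in `L¹(P_N)`): in the crux's vocabulary (cube kernel `K`, box fields `Dn, Mm, En`,
box temperature `Th`, cut compressibility `Zc`, cut pressure `Pc`, collision functional `Cw`), for `0 ≤ σ`, `0 ≤ η₁`,
`|Z| ≤ Z_max` on `[0, η₁]`, ANY profile functions whose local Gibbs laws `P_N` are probability measures under which the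
kinetic energy per particle `e_N(z) = (N+1)⁻¹ Σ_a ‖v_a‖²` has a second moment bounded uniformly in `N`
(`∫⁻ ofReal (e_N²) dP_N ≤ ofReal C₂`), every flow family, every window `0 < ℓ_N ≤ 1`, every `τ ∈ [0, T)`, every `w`
smooth on `[0,T) × 𝕋³` for which the crux's momentum-balance DEFECT `D_N` is `P_N`-a.e.-measurable:

  `CollDev_N → 0` in `P_N`-probability  ⟹  `∫⁻ |CollDev_N| dP_N → 0`,

`CollDev_N(z) = C_w(z) − ∫_0^τ∫ ρ̂θ̂ (Z(min(ρ̂σ³, η₁)) − 1) div w`. Proof: the landed abstract upgrade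
`FluxClosureUI.tendsto_lintegral_abs_of_dominated_inMeasure` (energy-dominated convergence in probability implies
`L¹` convergence) with `X_N := CollDev_N`, `e_N` the kinetic energy per particle and
`B := W₀ + τ W₁/2 + τ C (28 + Z_max)`, where `W₀, W₁, C` bound `‖w‖, ‖∂ₜw‖, |∂_jw_i|` on `[0, τ] × 𝕋³`
(compactness, `FluxClosureB4.exists_measurable_fderiv`, `FluxClosureK.exists_forall_abs_partialDeriv_le_slab`): the
domination `|CollDev_N| ≤ B (1 + e_N)` holds on the good set (`FluxClosureVT.abs_collDev_le`), which carries `P_N`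
(`EntropyClockDock.ae_mem_good_localGibbsLaw`); `CollDev_N` is `P_N`-a.e.-measurable because, by the exact balance
identity `FluxClosureGlue.boxMomentumBalance` (`D_N = CollDev_N + KinDev_N` on the good set), it is a `P_N`-a.e.
modification of `D_N − KinDev_N`, with `D_N` a.e.-measurable by hypothesis and `KinDev_N` by the balance lemma's first
conjunct (`FluxClosureB5.stub_kinDevAEMeasurable`); `e_N` is measurable (a finite sum of squared norms of
coordinates). No definitions, no collision estimate. References: H. Spohn, *Large Scale Dynamics of Interacting
Particles* (1991), Part I §3.2–3.3.
-/

noncomputable section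

namespace Summit.AtomisticToContinuum.HydrodynamicLimit.Theorems
namespace FluxClosureFmt.W2b

open scoped BigOperators Topology Classical MeasureTheory ProbabilityTheory InnerProductSpace ENNReal
open Filter Set Function MeasureTheory
open Literature.MathematicalPhysics.KineticTheory Literature.Analysis.FluidPDE Literature.Analysis.FunctionSpaces
open Summit.AtomisticToContinuum.HydrodynamicLimit.Theses.BoxDissipativeWeakStrong
open Summit.AtomisticToContinuum.HydrodynamicLimit.Theorems.EntropyClockDock (ae_mem_good_localGibbsLaw)

/-- **`V` in `L¹(P_N)` from `V` in `P_N`-probability (wave-2 format lemma W2b of crux `FluxClosure`).** In the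
crux's vocabulary: for `0 ≤ σ`, `0 ≤ η₁`, `0 ≤ C₂`, `|Z| ≤ Z_max` on `[0, η₁]`, profile functions `a₀, θ₀, u₀` whose
local Gibbs laws `P_N = localGibbsLaw σ a₀ u₀ θ₀ N (Φ N)` are probability measures with
`∫⁻ ofReal (e_N²) dP_N ≤ ofReal C₂` (`e_N = (N+1)⁻¹Σ_a‖v_a‖²`), flow family `Φ`, windows `0 < ℓ_N ≤ 1`, every
`τ ∈ [0,T)` and every `w` smooth on `[0,T) × 𝕋³` whose momentum-balance defect `D_N` is `P_N`-a.e.-measurable for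
every `N`: `P_N {δ < |CollDev_N|} → 0` for all `δ > 0` implies `∫⁻ ofReal |CollDev_N| dP_N → 0`.
Proof: `FluxClosureUI.tendsto_lintegral_abs_of_dominated_inMeasure` with `X_N := CollDev_N`, `e_N`,
`B := W₀ + τ W₁/2 + τ C (28 + Z_max)` (`W₀, W₁, C` produced from `hw` as in `FluxClosureVT.collisionalVirial_tight`),
the domination `|CollDev_N| ≤ B (1 + e_N)` on the good set (`FluxClosureVT.abs_collDev_le`, `P_N`-a.e. by
`ae_mem_good_localGibbsLaw`), a.e.-measurability of `CollDev_N` as an a.e.-modification of `D_N − KinDev_N`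
(`FluxClosureGlue.boxMomentumBalance`, `AEMeasurable.congr`) and measurability of `e_N`. -/
theorem collisionalVirial_of_inProbability : ∀ (σ η₁ : ℝ) (a₀ θ₀ : T3 → ℝ) (u₀ : T3 → V3) (C₂ Zmax T : ℝ) (Φ : (N : ℕ) → HardSphereFlow (Torus.geometry (Fin 3)) (hsDiameter σ N) (N + 1)) (ℓ : ℕ → ℝ), (∀ N, 0 < ℓ N ∧ ℓ N ≤ 1) → 0 ≤ σ → 0 ≤ η₁ → 0 ≤ C₂ → (∀ η ∈ Icc 0 η₁, |hsCompressibility η| ≤ Zmax) → (∀ N, IsProbabilityMeasure (localGibbsLaw σ a₀ u₀ θ₀ N (Φ N))) → (∀ N, ∫⁻ z, ENNReal.ofReal (((((N + 1 : ℕ) : ℝ))⁻¹ * ∑ a, ‖(z a).2‖ ^ 2) ^ 2) ∂(localGibbsLaw σ a₀ u₀ θ₀ N (Φ N)) ≤ ENNReal.ofReal C₂) → let K := fun (l : ℝ) (x y : T3) => indicator {y' : T3 | ∀ i, ‖y' i - x i‖ < l / 2} (fun _ => (l ^ 3)⁻¹) y; let Dn := fun N t z x => empiricalDensityField ((Φ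 N).flow t z) (K (ℓ N) x); let Mm := fun N t z x => empiricalMomentumField ((Φ N).flow t z) (K (ℓ N) x); let En := fun N t z x => empiricalEnergyField ((Φ N).flow t z) (K (ℓ N) x); let Th := fun (r : ℝ) (m : V3) (E : ℝ) => 2 / 3 * (E / r - ‖m‖ ^ 2 / (2 * r ^ 2)); let Zc := fun η : ℝ => hsCompressibility (min η η₁); let Pc := fun r ϑ : ℝ => r * ϑ * Zc (r * σ ^ 3); ∀ τ ∈ Ico 0 T, ∀ w : ℝ → T3 → V3, Torus.IsSmoothSpaceTimeOn (Ico 0 T) w → (∀ N, AEMeasurable (fun z : Config (N + 1) (Fin 3) T3 => (∫ x, inner ℝ (Mm N τ z x) (w τ x)) - (∫ x, inner ℝ (Mm N 0 z x) (w 0 x)) - ∫ t in Ioc 0 τ, ∫ x, (inner ℝ (Mm N t z x) (Torus.timeDerivWithin (Ico 0 T) w t x) + (∑ i, ∑ j, Mm N t z x i * Mm N t z x j / Dn N t z x * Torus.partialDeriv j (fun y => w t y i) x) + Pc (Dn N t z x) (Th (Dn N t z x) (Mm N t z x) (En N t z x)) * Torus.divergence (w t) x)) (localGibbsLaw σ a₀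 u₀ θ₀ N (Φ N))) → let Cw := fun N (z : Config (N + 1) (Fin 3) T3) => ∑ᶠ t ∈ collisionTimes (Torus.geometry (Fin 3)) (hsDiameter σ N) (fun s => (Φ N).flow s z) ∩ Ioc 0 τ, collisionJump (fun z' : Config (N + 1) (Fin 3) T3 => ((N : ℝ) + 1)⁻¹ * momentumObservable (fun q => ∫ x, K (ℓ N) x q • w t x) z') (fun s => (Φ N).flow s z) t; (∀ δ : ℝ, 0 < δ → Tendsto (fun N : ℕ => localGibbsLaw σ a₀ u₀ θ₀ N (Φ N) {z | δ < |Cw N z - ∫ t in Ioc 0 τ, ∫ x, Dn N t z x * Th (Dn N t z x) (Mm N t z x) (En N t z x) * (Zc (Dn N t z x * σ ^ 3) - 1) * Torus.divergence (w t) x|}) atTop (𝓝 0)) → Tendsto (fun N : ℕ => ∫⁻ z, ENNReal.ofReal (|Cw N z - ∫ t in Ioc 0 τ, ∫ x, Dn N t z x * Th (Dn N t z x) (Mm N t z x) (En N t z x) * (Zc (Dn N t z x * σ ^ 3) - 1) * Torus.divergence (w t) x|) ∂(localGibbsLaw σ a₀ u₀ θ₀ N (Φ N))) atTop (𝓝 0)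 := by
  intro σ η₁ a₀ θ₀ u₀ C₂ Zmax T Φ ℓ hℓ hσ hη₁ hC₂ hZ hP he2
  dsimp only
  intro τ hτ w hw hDm hprob
  have hτ0 : 0 ≤ τ := hτ.1
  have hτT : τ < T := hτ.2
  -- bounds for `w`, `∂ₜw`, `∇w` on `[0, τ] × 𝕋³` (as in `FluxClosureVT.collisionalVirial_tight`)
  obtain ⟨C, hC0, hC⟩ := FluxClosureK.exists_forall_abs_partialDeriv_le_slab hτT hw
  obtain ⟨W, hW⟩ := hw.exists_norm_le_of_isCompact isCompact_Icc (Icc_subset_Ico_right hτT)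
  obtain ⟨H, C₁, -, hHt, -, hHb⟩ := FluxClosureB4.exists_measurable_fderiv hτT hw
  have hW0 : 0 ≤ max W 0 := le_max_right _ _
  have hW₁0 : 0 ≤ max C₁ 0 := le_max_right _ _
  have hWt : ∀ t ∈ Icc 0 τ, ∀ x, ‖w t x‖ ≤ max W 0 := fun t ht x => (hW t ht x).trans (le_max_left _ _)
  have hDt : ∀ t ∈ Ioc 0 τ, ∀ x, ‖Torus.timeDerivWithin (Ico 0 T) w t x‖ ≤ max C₁ 0 := by
    intro t ht x
    have htT : t ∈ Ico 0 T := ⟨ht.1.le, lt_of_le_of_lt ht.2 hτT⟩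
    rw [hHt t htT x]
    calc ‖H (t, x) (1, 0)‖ ≤ ‖H (t, x)‖ * ‖((1 : ℝ), (0 : EuclideanSpace ℝ (Fin 3)))‖ :=
          ContinuousLinearMap.le_opNorm _ _
      _ ≤ C₁ * 1 := by
          refine mul_le_mul (hHb t ⟨ht.1.le, ht.2⟩ x) ?_ (norm_nonneg _)
            ((norm_nonneg _).trans (hHb t ⟨ht.1.le, ht.2⟩ x))
          rw [Prod.norm_def, norm_one, norm_zero, max_eq_left zero_le_one]
      _ ≤ max C₁ 0 := by rw [mul_one]; exact le_max_left _ _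
  have hZ0 : 0 ≤ Zmax := (abs_nonneg _).trans (hZ 0 ⟨le_rfl, hη₁⟩)
  have hBc0 : 0 ≤ max W 0 + τ * max C₁ 0 / 2 + τ * C * (28 + Zmax) := by positivity
  -- pathwise domination on the good set
  have hPth := FluxClosureVT.abs_collDev_le σ η₁ T Φ ℓ hℓ hσ hη₁ Zmax hZ
  dsimp only at hPth
  have hPN := hPth τ hτ w hw (max W 0) (max C₁ 0) C hW0 hW₁0 hC0 hWt hDt hC
  clear hPth
  -- the exact balance identity: `D_N = CollDev_N + KinDev_N` on the good set, `KinDev_N` a.e.-measurable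
  have hbal := FluxClosureGlue.boxMomentumBalance σ η₁ T a₀ θ₀ u₀ Φ ℓ hℓ
  dsimp only at hbal
  have hbalN := hbal τ hτ w hw
  clear hbal
  -- the kinetic energy per particle is measurable
  have hem : ∀ N : ℕ, Measurable fun z : Config (N + 1) (Fin 3) T3 => (((N + 1 : ℕ) : ℝ))⁻¹ * ∑ a, ‖(z a).2‖ ^ 2 :=
    fun N => measurable_const.mul (Finset.measurable_sum _ fun i _ => ((measurable_pi_apply i).snd).norm.pow_const 2)
  haveI : ∀ N, IsProbabilityMeasure (localGibbsLaw σ a₀ u₀ θ₀ N (Φ N)) := hP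
  refine FluxClosureUI.tendsto_lintegral_abs_of_dominated_inMeasure
    (fun N => localGibbsLaw σ a₀ u₀ θ₀ N (Φ N)) _
    (fun N (z : Config (N + 1) (Fin 3) T3) => (((N + 1 : ℕ) : ℝ))⁻¹ * ∑ a, ‖(z a).2‖ ^ 2)
    (max W 0 + τ * max C₁ 0 / 2 + τ * C * (28 + Zmax)) C₂ hBc0 hC₂ (fun N => ?_)
    (fun N => (hem N).aemeasurable) (fun N => ae_of_all _ fun z => by positivity) (fun N => ?_) he2 hprob
  · -- `CollDev_N` is a `P_N`-a.e. modification of the a.e.-measurable `D_N - KinDev_N`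
    refine ((hDm N).sub (hbalN N).1).congr ?_
    filter_upwards [ae_mem_good_localGibbsLaw σ a₀ θ₀ u₀ N (Φ N)] with z hz
    exact sub_eq_of_eq_add ((hbalN N).2 z hz)
  · -- the domination holds on the good set, which carries `P_N`
    filter_upwards [ae_mem_good_localGibbsLaw σ a₀ θ₀ u₀ N (Φ N)] with z hz
    exact hPN N z hz

end FluxClosureFmt.W2b
end Summit.AtomisticToContinuum.HydrodynamicLimit.Theorems

end
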